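import Summits.CriticalPhenomena.PercolationContinuityZ3.Theorems.PercNearOneGluingNoHeavyLowerTailMajorityGluingQCert3SixFourEval
import Summits.CriticalPhenomena.PercolationContinuityZ3.Theorems.PercNearOneGluingNoHeavyLowerTailMajorityGluingQCert3Range
import Summits.CriticalPhenomena.PercolationContinuityZ3.Theorems.PercNearOneGluingNoHeavyLowerTailMajorityGluingEightHarris
import HarnessLib

/-!
# Four of six relays cut: `μ ≤ (61/50)·max_i μ(vᵢ ↮ a₀)` by a kernel-checked DEGREE-3 certificate; `C(8), C(9) ≤ 111/50`, `= 2` for `max ≥ 11/61` (lane prim-rate, constants-miner 1, gen 34; CANDIDATES §GEN-34 R329)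

Support file for the closed crux `NoHeavyLowerTail` (stmt-CriticalPhenomena-4575), majority-gluing line.  The degree-2 certificate language is infeasible at `c = 5/4` for the
cell `(6,4)`; ONE Sherali–Adams lift (`…QCert3`) reaches `61/50`: the exact rational certificate of kit j271241 (1 000 `ell2` + 10 799 multipliers, translated by
census/g34/cert/gen3.py, 381 217 contributions) is `QCert.sixFour3` (`…QCert3SixFour*`: data and `checkW3`; `…QCert3SixFourSl01–33`: the 65 smallest-index slice checks by `decide +kernel`; `…QCert3SixFourEval`: `sixFour3_eval`).
`cut_of_eval3_count` gives **`fourOfSix_cert3` : `μ(4 ≤ #{v ∈ T : v ↮ a₀}) ≤ (61/50)·δ`** for every finite weighted graph, and the generic Harris layer of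
`…MajorityGluingEightHarris` gives **`majorityGluing_card_eight_nine_cert3` (C(8), C(9) ≤ 111/50)**, **`majorityGluing_two_card_eight_nine_of_ge_cert3` (loss `2·max` whenever
`max ≥ 11/61`)** and the Harris form.  No sorries. [cite: VandenbergKahn2001, Thm 1.2 (p. 123)] [cite: KozmaNitzan2024, Conj. 1 (p. 3), Conj. 4 (p. 32)]
-/

noncomputable section

namespace Summit.CriticalPhenomena.PercolationContinuityZ3.Theorems

open MeasureTheory Set
open Literature.Probability.LatticeModels (prodBernoulli)
open Literature.Probability.Percolation
open scoped Classical

namespace HubOnly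

variable {n : ℕ}

/-- **AT LEAST FOUR OF SIX RELAYS CUT: `μ ≤ (61/50)·δ`** by the kernel-checked degree-3 certificate `QCert.sixFour3`. [cite: VandenbergKahn2001, Thm 1.2 (p. 123)] -/
theorem fourOfSix_cert3 (w : Sym2 (Fin n) → unitInterval) (a₀ : Fin n) (T : Finset (Fin n)) (hT : T.card = 6) (δ : ℝ)
    (hδ : ∀ v ∈ T, (prodBernoulli w).real (openConn v a₀ : Set (BondConfig (Fin n)))ᶜ ≤ δ) :
    (prodBernoulli w).real {ω : BondConfig (Fin n) | 4 ≤ (T.filter fun v => ω ∉ openConn v a₀).card} ≤ 61 / 50 * δ := by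
  obtain ⟨v, hv⟩ : T.Nonempty := by rw [← Finset.card_pos, hT]; norm_num
  have hδ0 : 0 ≤ δ := le_trans measureReal_nonneg (hδ v hv)
  have h := QCert.cut_of_eval3_count QCert.sixFour3 rfl rfl QCert.sixFour3_checkW3 QCert.sixFour3_eval w a₀ T hT δ hδ0 hδ
  have hcD : (QCert.sixFour3.base.cD : ℝ) = 50 := by norm_num [QCert.sixFour3]
  have hcN : (QCert.sixFour3.base.cN : ℝ) = 61 := by norm_num [QCert.sixFour3]
  have hh : QCert.sixFour3.base.h = 4 := rfl
  rw [hcD, hcN, hh] at h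
  linarith

/-- The cells of `|A| ∈ {8, 9}` obey `(61/50)·δ` (`(6,4)` by `fourOfSix_cert3`, `(7,5)` by `cutCount_mono`). [cite: VandenbergKahn2001, Thm 1.2 (p. 123)] -/
theorem cell_eight_nine_cert3 (p : Sym2 (Fin n) → unitInterval) (A : Finset (Fin n)) (a₀ : Fin n) (h8 : 8 ≤ A.card) (h9 : A.card ≤ 9)
    (T : Finset (Fin n)) (δ : ℝ) (haT : a₀ ∉ T) (_hTA : T ⊆ A) (hTcard : T.card + 2 = A.card) (_hδ : 0 ≤ δ)
    (hδT : ∀ v ∈ T, (prodBernoulli p).real (openConn v a₀ : Set (BondConfig (Fin n)))ᶜ ≤ δ) :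
    (prodBernoulli p).real {ω : BondConfig (Fin n) | (A.card + 1) / 2 ≤ (T.filter fun v => ω ∉ openConn v a₀).card} ≤ 61 / 50 * δ :=
  cutCount_mono p a₀ 6 4 δ (61 / 50 * δ) (fun T₀ hT₀ _ hδT₀ => fourOfSix_cert3 p a₀ T₀ hT₀ δ hδT₀) T ((A.card + 1) / 2)
    (by omega) (by omega) haT hδT

/-- **MAJORITY GLUING AT `|A| ∈ {8, 9}` WITH LOSS `(111/50)·max`** (degree-3 certificate; was `113/50`). [cite: VandenbergKahn2001, Thm 1.2 (p. 123)] [cite: KozmaNitzan2024, Conj. 1 (p. 3)] -/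
theorem majorityGluing_card_eight_nine_cert3 (w : Sym2 (Fin n) → unitInterval) (A : Finset (Fin n)) (o a₀ : Fin n) (δ₀ : ℝ)
    (ha₀ : a₀ ∈ A) (h8 : 8 ≤ A.card) (h9 : A.card ≤ 9)
    (hδ₀ : ∀ a ∈ A, (prodBernoulli w).real (openConn a a₀ : Set (BondConfig (Fin n)))ᶜ ≤ δ₀) :
    (prodBernoulli w).real (⋃ a ∈ A, openConn o a) - 111 / 50 * δ₀ ≤
      (prodBernoulli w).real {ω : BondConfig (Fin n) | ω ∈ openConn o a₀ ∧
          A.card < 2 * (A.filter fun a => ω ∈ openConn o a).card} := by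
  have h := majorityGluing_of_cellConst w A o a₀ δ₀ ha₀ (by omega) (61 / 50) (by norm_num)
    (fun p _ T δ haT hTA hTcard hδ hδT => cell_eight_nine_cert3 p A a₀ h8 h9 T δ haT hTA hTcard hδ hδT) hδ₀
  norm_num at h ⊢
  linarith

/-- **MAJORITY GLUING AT `|A| ∈ {8, 9}`, HARRIS FORM** (degree-3 certificate): loss `δ₀ + (61/50)·δ₀·(1 − δ₀)` for `δ₀ ≤ 50/61`.
[cite: VandenbergKahn2001, Thm 1.2 (p. 123)] [cite: KozmaNitzan2024, Conj. 1 (p. 3)] -/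
theorem majorityGluing_harris_card_eight_nine_cert3 (w : Sym2 (Fin n) → unitInterval) (A : Finset (Fin n)) (o a₀ : Fin n) (δ₀ : ℝ)
    (ha₀ : a₀ ∈ A) (h8 : 8 ≤ A.card) (h9 : A.card ≤ 9)
    (hδ₀ : ∀ a ∈ A, (prodBernoulli w).real (openConn a a₀ : Set (BondConfig (Fin n)))ᶜ ≤ δ₀) (hδ₀' : δ₀ ≤ 50 / 61) :
    (prodBernoulli w).real (⋃ a ∈ A, openConn o a) -
        (prodBernoulli w).real {ω : BondConfig (Fin n) | ω ∈ openConn o a₀ ∧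
          A.card < 2 * (A.filter fun a => ω ∈ openConn o a).card}
      ≤ δ₀ + 61 / 50 * δ₀ * (1 - δ₀) :=
  majorityGluing_harris_of_cellConst w A o a₀ δ₀ ha₀ (by omega) (61 / 50) (by norm_num)
    (fun p _ T δ haT hTA hTcard hδ hδT => cell_eight_nine_cert3 p A a₀ h8 h9 T δ haT hTA hTcard hδ hδT) hδ₀ (by linarith)

/-- **`C(8) = C(9) = 2` WHENEVER `max ≥ 11/61`** (degree-3 certificate; was `13/63`). [cite: VandenbergKahn2001, Thm 1.2 (p. 123)] [cite: KozmaNitzan2024, Conj. 1 (p. 3), Conj. 4 (p. 32)] -/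
theorem majorityGluing_two_card_eight_nine_of_ge_cert3 (w : Sym2 (Fin n) → unitInterval) (A : Finset (Fin n)) (o a₀ : Fin n)
    (δ₀ : ℝ) (ha₀ : a₀ ∈ A) (h8 : 8 ≤ A.card) (h9 : A.card ≤ 9)
    (hδ₀ : ∀ a ∈ A, (prodBernoulli w).real (openConn a a₀ : Set (BondConfig (Fin n)))ᶜ ≤ δ₀) (h1161 : 11 / 61 ≤ δ₀) :
    (prodBernoulli w).real (⋃ a ∈ A, openConn o a) - 2 * δ₀ ≤
      (prodBernoulli w).real {ω : BondConfig (Fin n) | ω ∈ openConn o a₀ ∧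
          A.card < 2 * (A.filter fun a => ω ∈ openConn o a).card} :=
  majorityGluing_two_of_cellConst w A o a₀ δ₀ ha₀ (by omega) (61 / 50) (by norm_num)
    (fun p _ T δ haT hTA hTcard hδ hδT => cell_eight_nine_cert3 p A a₀ h8 h9 T δ haT hTA hTcard hδ hδT) hδ₀ (by linarith)

end HubOnly

end Summit.CriticalPhenomena.PercolationContinuityZ3.Theorems

end
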